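import Summits.AtomisticToContinuum.HydrodynamicLimit.Theorems.AntiMazurCoboundariesCellForecastPressureDecayContactLayerBoundsA
import HarnessLib

/-!
# S2c(G) · bulk invariance of the brackets of the two-marked expansion under rotations about the marked centre
# (piece of stub `stub_contactStatistics`, crux line `enskog-compensator-martingale`,
# crux `CellForecastPressureDecay`, stmt-AtomisticToContinuum-13915)

The weak isotropy of the pair law of the cell (the cluster-expansion input of `ContactStatistics`, companion files)
rests on ONE geometric fact: a bracket `∫ 𝟙_{bulk}(xᵢ) ψ(xᵢ − xⱼ) U(x) dν^{⊗n}` of the two-marked decorated expansion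
(`U` = product of Ursell weights of clusters `S ∋ i, j`, supported on configurations of `S` within distance `D` of
`xᵢ`; `ν` the uniform law on the cube) does not change when `ψ` is replaced by `ψ ∘ h` for a linear isometry `h` of
`ℝ³`, as long as `xᵢ` is at depth `≥ D` in the cube. This file proves it:

* § 1 the **recentred isometry** `x ↦ (k ↦ xᵢ + h(x_k − xᵢ) for k ∈ S, x_k otherwise)` preserves Lebesgue measure
  on `(ℝ³)ⁿ` (one coordinate at a time: a fibrewise affine isometry, `MeasurePreserving.skew_product` conjugated by
  `MeasurableEquiv.piFinSuccAbove`; then induction on `S`);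
* § 2 it preserves the overlap graph of the labels in `S`, hence their Ursell weights (`hcUrsell_congr`), and a
  non-vanishing Ursell weight forces its cluster within `(#B − 1)σ` of any of its points (`hcUrsell_ne_zero_le`);
* § 3 `integral_bulk_bracket_eq` — the **bulk invariance of the brackets** (change of variables; at depth `≥ D` the
  cube constraint on the labels of `S` is inactive before and after recentring), and the registered sub-goal
  `stub_contactStatistics_bulk`.

References: folklore (isometry invariance of Lebesgue measure); E. Pulvirenti, D. Tsagkarogiannis, Comm. Math.
Phys. 316 (2012) 289–306, §3 (the brackets = activities of the two-marked polymer expansion).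
-/

noncomputable section

open MeasureTheory ProbabilityTheory Set Filter
open scoped ENNReal BigOperators
open Literature.Analysis.FluidPDE Literature.MathematicalPhysics.KineticTheory
open Literature.MathematicalPhysics.StatisticalMechanics
open Summit.AtomisticToContinuum.HydrodynamicLimit.Theorems.CellForecastPressureDecay
  (cellCube cellCube_eq_preimage measurableSet_cellCube volume_cellCube abs_apply_sub_apply_le)

namespace Summit.AtomisticToContinuum.HydrodynamicLimit.Theorems.EnskogCompensator

/-! ## § 1 The recentred isometry preserves Lebesgue measure -/

/-- **One coordinate**: for `i ≠ k` and a linear isometry `h`, `x ↦ update x k (xᵢ + h(x_k − xᵢ))` preserves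
Lebesgue measure on `(ℝ³)^{m+1}` (a fibrewise affine isometry of the coordinate `k`). [folklore] -/
theorem measurePreserving_update_recentre {m : ℕ} (h : V3 ≃ₗᵢ[ℝ] V3) {i k : Fin (m + 1)} (hik : i ≠ k) :
    MeasurePreserving (fun x : Fin (m + 1) → V3 => Function.update x k (x i + h (x k - x i))) volume volume := by
  obtain ⟨i', hi'⟩ := Fin.exists_succAbove_eq hik
  set e := MeasurableEquiv.piFinSuccAbove (fun _ : Fin (m + 1) => V3) k with he
  -- the fibrewise map, base first
  have hΨ' : MeasurePreserving (fun p : (Fin m → V3) × V3 => (p.1, p.1 i' + h (p.2 - p.1 i')))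
      ((volume : Measure (Fin m → V3)).prod (volume : Measure V3)) (volume.prod volume) := by
    have hgm : Measurable (Function.uncurry fun (y : Fin m → V3) (a : V3) => y i' + h (a - y i')) :=
      ((measurable_pi_apply i').comp measurable_fst).add
        (h.continuous.measurable.comp (measurable_snd.sub ((measurable_pi_apply i').comp measurable_fst)))
    have hmap : ∀ᵐ y : Fin m → V3 ∂volume,
        Measure.map ((fun (y : Fin m → V3) (a : V3) => y i' + h (a - y i')) y) volume = volume :=
      Eventually.of_forall fun y => ((measurePreserving_add_left volume (y i')).comp
        (h.measurePreserving.comp (measurePreserving_sub_right volume (y i')))).map_eq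
    exact MeasurePreserving.skew_product (μc := (volume : Measure V3)) (μd := (volume : Measure V3))
      (MeasurePreserving.id (volume : Measure (Fin m → V3))) hgm hmap
  have hΨ : MeasurePreserving (fun p : V3 × (Fin m → V3) => (p.2 i' + h (p.1 - p.2 i'), p.2))
      ((volume : Measure V3).prod (volume : Measure (Fin m → V3))) (volume.prod volume) :=
    (Measure.measurePreserving_swap.comp hΨ').comp Measure.measurePreserving_swap
  have hT : (fun x : Fin (m + 1) → V3 => Function.update x k (x i + h (x k - x i))) =
      e.symm ∘ (fun p : V3 × (Fin m → V3) => (p.2 i' + h (p.1 - p.2 i'), p.2)) ∘ e := by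
    funext x
    simp only [Function.comp_apply, he, MeasurableEquiv.piFinSuccAbove_apply,
      MeasurableEquiv.piFinSuccAbove_symm_apply, Fin.insertNthEquiv, Equiv.coe_fn_symm_mk, Equiv.coe_fn_mk]
    symm
    rw [Fin.insertNth_eq_iff]
    refine ⟨?_, (Fin.removeNth_update k _ x).symm⟩
    simp [Fin.removeNth, hi']
  rw [hT]
  exact ((volume_preserving_piFinSuccAbove (fun _ : Fin (m + 1) => V3) k).symm e).comp
    (hΨ.comp (volume_preserving_piFinSuccAbove (fun _ : Fin (m + 1) => V3) k))

/-- **The recentred isometry of the labels `S` about the label `i` preserves Lebesgue measure** on `(ℝ³)^{m+1}`: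
`x ↦ (k ↦ xᵢ + h(x_k − xᵢ) if k ∈ S, x_k otherwise)` (the label `i` itself is fixed either way). [folklore] -/
theorem measurePreserving_recentre {m : ℕ} (h : V3 ≃ₗᵢ[ℝ] V3) (i : Fin (m + 1)) (S : Finset (Fin (m + 1))) :
    MeasurePreserving (fun x : Fin (m + 1) → V3 => fun k => if k ∈ S then x i + h (x k - x i) else x k)
      volume volume := by
  induction S using Finset.induction_on with
  | empty =>
    simp only [Finset.notMem_empty, if_false]
    exact MeasurePreserving.id volume
  | @insert k S hk ih =>
    by_cases hki : k = i
    · subst hki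
      have heq : (fun x : Fin (m + 1) → V3 => fun l => if l ∈ insert k S then x k + h (x l - x k) else x l) =
          fun x => fun l => if l ∈ S then x k + h (x l - x k) else x l := by
        funext x l
        by_cases hl : l = k
        · subst hl; simp
        · simp [Finset.mem_insert, hl]
      rw [heq]
      exact ih
    · have heq : (fun x : Fin (m + 1) → V3 => fun l => if l ∈ insert k S then x i + h (x l - x i) else x l) =
          (fun x : Fin (m + 1) → V3 => Function.update x k (x i + h (x k - x i))) ∘
            fun x => fun l => if l ∈ S then x i + h (x l - x i) else x l := by
        funext x l
        simp only [Function.comp_apply]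
        have hii : (if i ∈ S then x i + h (x i - x i) else x i) = x i := by split_ifs <;> simp
        by_cases hl : l = k
        · subst hl
          rw [Function.update_self, if_pos (Finset.mem_insert_self l S), hii, if_neg hk]
        · rw [Function.update_of_ne hl]
          simp [Finset.mem_insert, hl]
      rw [heq]
      exact (measurePreserving_update_recentre h (Ne.symm hki)).comp ih

/-! ## § 2 The recentred isometry preserves overlap graphs and Ursell weights; locality -/

/-- Recentring fixes the centre. [folklore] -/
theorem recentre_apply_self {m : ℕ} (h : V3 ≃ₗᵢ[ℝ] V3) (i : Fin (m + 1)) (S : Finset (Fin (m + 1)))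
    (x : Fin (m + 1) → V3) :
    (fun k => if k ∈ S then x i + h (x k - x i) else x k) i = x i := by
  show (if i ∈ S then x i + h (x i - x i) else x i) = x i
  split_ifs <;> simp

/-- Recentring is an isometry on the labels of `S`. [folklore] -/
theorem recentre_sub_recentre {m : ℕ} (h : V3 ≃ₗᵢ[ℝ] V3) (i : Fin (m + 1)) {S : Finset (Fin (m + 1))}
    (x : Fin (m + 1) → V3) {k l : Fin (m + 1)} (hk : k ∈ S) (hl : l ∈ S) :
    (fun k => if k ∈ S then x i + h (x k - x i) else x k) k -
        (fun k => if k ∈ S then x i + h (x k - x i) else x k) l = h (x k - x l) := by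
  show (if k ∈ S then x i + h (x k - x i) else x k) - (if l ∈ S then x i + h (x l - x i) else x l) = h (x k - x l)
  rw [if_pos hk, if_pos hl, add_sub_add_left_eq_sub, ← map_sub]
  congr 1
  abel

/-- **Recentring preserves the Ursell weights of the clusters inside `S`** (the overlap graph on `S` is preserved).
[folklore] -/
theorem uR_recentre {m : ℕ} (σ : ℝ) (h : V3 ≃ₗᵢ[ℝ] V3) (i : Fin (m + 1)) {S B : Finset (Fin (m + 1))}
    (hBS : B ⊆ S) (x : Fin (m + 1) → V3) :
    uR (fun y y' : V3 => ‖y - y'‖ < σ) (fun k => if k ∈ S then x i + h (x k - x i) else x k) B =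
      uR (fun y y' : V3 => ‖y - y'‖ < σ) x B := by
  unfold uR
  congr 1
  refine Literature.Probability.LatticeModels.hcUrsell_congr fun u hu w hw => ?_
  simp only [overlapRel]
  rw [recentre_sub_recentre h i x (hBS hu) (hBS hw), LinearIsometryEquiv.norm_map]

/-- **Locality of the Ursell weights**: a non-vanishing `u_B(x)` forces every two centres of `B` within
`(#B − 1)σ` (the overlap graph on `B` is connected). [cite: FriedliVelenik2017, §5.3 (5.5)] -/
theorem norm_sub_le_of_uR_ne_zero {n : ℕ} {σ : ℝ} (hσ : 0 ≤ σ) {x : Fin n → V3} {B : Finset (Fin n)}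
    (hB : uR (fun y y' : V3 => ‖y - y'‖ < σ) x B ≠ 0) :
    ∀ u ∈ B, ∀ w ∈ B, ‖x u - x w‖ ≤ ((B.card : ℝ) - 1) * σ := by
  have hne : Literature.Probability.LatticeModels.hcUrsell (overlapRel (fun y y' : V3 => ‖y - y'‖ < σ) x) B ≠ 0 := by
    intro h0; apply hB; unfold uR; rw [h0]; simp
  exact Literature.Probability.LatticeModels.hcUrsell_ne_zero_le
    (overlapRel_symm (fun a b hab => by simpa [norm_sub_rev] using hab) x) (fun a b => ‖x a - x b‖) hσ
    (fun a b c => norm_sub_le_norm_sub_add_norm_sub _ _ _) (fun a => by simp) (fun a b hab => hab.2.le) hne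

/-! ## § 3 The bulk invariance of the brackets -/

/-- The bulk region at depth `D` of the cube is measurable. [folklore] -/
theorem measurableSet_bulk (L D : ℝ) : MeasurableSet {y : V3 | ∀ c, D ≤ y c ∧ y c ≤ L - D} := by
  have : {y : V3 | ∀ c, D ≤ y c ∧ y c ≤ L - D} =
      (WithLp.ofLp : V3 → (Fin 3 → ℝ)) ⁻¹' Set.Icc (fun _ => D) (fun _ => L - D) := by
    ext y
    simp only [mem_setOf_eq, mem_preimage, mem_Icc, Pi.le_def]
    exact ⟨fun hy => ⟨fun c => (hy c).1, fun c => (hy c).2⟩, fun hy c => ⟨hy.1 c, hy.2 c⟩⟩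
  rw [this]
  exact measurableSet_Icc.preimage (PiLp.volume_preserving_ofLp (Fin 3)).measurable

/-- A point within `D` of a centre at depth `≥ D` is in the cube. [folklore] -/
theorem mem_cellCube_of_bulk {L D : ℝ} {a z : V3} (ha : ∀ c, D ≤ a c ∧ a c ≤ L - D) (hz : ‖z - a‖ ≤ D) :
    z ∈ cellCube L := by
  intro c
  have h1 : |z c - a c| ≤ D := (abs_apply_sub_apply_le z a c).trans hz
  rw [abs_le] at h1
  obtain ⟨h2, h3⟩ := ha c
  exact ⟨by linarith, by linarith⟩

/-- **The pointwise identity behind the bulk invariance.** With `T` the recentred isometry of the labels `S ∋ i, j`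
about `i`, a weight `U` invariant under `T` and supported (together with the two-body weight) on configurations of
`S` within `D` of `xᵢ`, and the cube constraint written as the indicator of the box,
`(𝟙_{box} · 𝟙_{bulk}(xᵢ) ψ(xᵢ − xⱼ) U) ∘ T = 𝟙_{box} · 𝟙_{bulk}(xᵢ) ψ(h(xᵢ − xⱼ)) U`. [folklore] -/
theorem indicator_bracket_recentre {m : ℕ} (L : ℝ) (h : V3 ≃ₗᵢ[ℝ] V3) {S : Finset (Fin (m + 1))}
    {i j : Fin (m + 1)} (hi : i ∈ S) (hj : j ∈ S) {U : (Fin (m + 1) → V3) → ℝ}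
    (hU1 : ∀ x, U (fun k => if k ∈ S then x i + h (x k - x i) else x k) = U x) {D R₀ : ℝ}
    (hU2 : ∀ x, U x ≠ 0 → ‖x i - x j‖ ≤ R₀ → ∀ k ∈ S, ‖x k - x i‖ ≤ D) {ψ : V3 → ℝ}
    (hψs : ∀ q, ψ q ≠ 0 → ‖q‖ ≤ R₀) (x : Fin (m + 1) → V3) :
    (Set.pi Set.univ fun _ : Fin (m + 1) => cellCube L).indicator
        (fun x => {y : V3 | ∀ c, D ≤ y c ∧ y c ≤ L - D}.indicator (fun _ => (1 : ℝ)) (x i) * ψ (x i - x j) * U x)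
        (fun k => if k ∈ S then x i + h (x k - x i) else x k) =
      (Set.pi Set.univ fun _ : Fin (m + 1) => cellCube L).indicator
        (fun x => {y : V3 | ∀ c, D ≤ y c ∧ y c ≤ L - D}.indicator (fun _ => (1 : ℝ)) (x i) * ψ (h (x i - x j)) * U x)
        x := by
  set T : (Fin (m + 1) → V3) → (Fin (m + 1) → V3) := fun x => fun k => if k ∈ S then x i + h (x k - x i) else x k
    with hT
  have hTi : T x i = x i := recentre_apply_self h i S x
  have hTij : T x i - T x j = h (x i - x j) := recentre_sub_recentre h i x hi hj
  have hU1x : U (T x) = U x := hU1 x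
  have hG : {y : V3 | ∀ c, D ≤ y c ∧ y c ≤ L - D}.indicator (fun _ => (1 : ℝ)) (T x i) * ψ (T x i - T x j) *
      U (T x) = {y : V3 | ∀ c, D ≤ y c ∧ y c ≤ L - D}.indicator (fun _ => (1 : ℝ)) (x i) * ψ (h (x i - x j)) * U x := by
    rw [hTij, hTi, hU1x]
  by_cases hG0 : {y : V3 | ∀ c, D ≤ y c ∧ y c ≤ L - D}.indicator (fun _ => (1 : ℝ)) (x i) * ψ (h (x i - x j)) * U x = 0
  · have hl : (Set.pi Set.univ fun _ : Fin (m + 1) => cellCube L).indicator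
        (fun x => {y : V3 | ∀ c, D ≤ y c ∧ y c ≤ L - D}.indicator (fun _ => (1 : ℝ)) (x i) * ψ (x i - x j) * U x)
        (T x) = 0 := Set.indicator_apply_eq_zero.2 fun _ => hG.trans hG0
    have hr : (Set.pi Set.univ fun _ : Fin (m + 1) => cellCube L).indicator
        (fun x => {y : V3 | ∀ c, D ≤ y c ∧ y c ≤ L - D}.indicator (fun _ => (1 : ℝ)) (x i) * ψ (h (x i - x j)) * U x)
        x = 0 := Set.indicator_apply_eq_zero.2 fun _ => hG0
    exact hl.trans hr.symm
  · have h1 : x i ∈ {y : V3 | ∀ c, D ≤ y c ∧ y c ≤ L - D} := by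
      by_contra hc; exact hG0 (by rw [Set.indicator_of_notMem hc]; ring)
    have h2 : ψ (h (x i - x j)) ≠ 0 := fun hc => hG0 (by rw [hc]; ring)
    have h3 : U x ≠ 0 := fun hc => hG0 (by rw [hc]; ring)
    have hR : ‖x i - x j‖ ≤ R₀ := by have := hψs _ h2; rwa [LinearIsometryEquiv.norm_map] at this
    have hloc := hU2 x h3 hR
    have hmem : T x ∈ (Set.pi Set.univ fun _ : Fin (m + 1) => cellCube L) ↔
        x ∈ (Set.pi Set.univ fun _ : Fin (m + 1) => cellCube L) := by
      simp only [Set.mem_univ_pi]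
      refine forall_congr' fun k => ?_
      by_cases hk : k ∈ S
      · have hxk : x k ∈ cellCube L := mem_cellCube_of_bulk h1 (hloc k hk)
        have hTk : T x k ∈ cellCube L := by
          refine mem_cellCube_of_bulk h1 ?_
          rw [← hTi, recentre_sub_recentre h i x hk hi, LinearIsometryEquiv.norm_map]
          exact hloc k hk
        exact iff_of_true hTk hxk
      · have : T x k = x k := by show (if k ∈ S then x i + h (x k - x i) else x k) = x k; rw [if_neg hk]
        rw [this]
    by_cases hx : x ∈ (Set.pi Set.univ fun _ : Fin (m + 1) => cellCube L)
    · rw [Set.indicator_of_mem (hmem.2 hx), Set.indicator_of_mem hx]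
      exact hG
    · rw [Set.indicator_of_notMem (mt hmem.1 hx), Set.indicator_of_notMem hx]

/-- **Bulk invariance of the brackets.** Under the `(m+1)`-fold power of the uniform law on the cube, for labels
`i, j ∈ S`, a measurable weight `U` invariant under the recentred isometry of `S` about `i` and local
(`U(x) ≠ 0`, `‖xᵢ − xⱼ‖ ≤ R₀` force every label of `S` within `D` of `xᵢ`), and a measurable two-body weight `ψ`
supported in `‖q‖ ≤ R₀`:
`∫ 𝟙_{depth ≥ D}(xᵢ) ψ(xᵢ − xⱼ) U(x) = ∫ 𝟙_{depth ≥ D}(xᵢ) ψ(h(xᵢ − xⱼ)) U(x)` for every linear isometry `h` —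
the power of the uniform law is Lebesgue measure conditioned on the box, on the support the box constraint is the
same before and after recentring, and recentring preserves Lebesgue measure. [folklore] -/
theorem integral_bulk_bracket_eq {m : ℕ} (L : ℝ) (h : V3 ≃ₗᵢ[ℝ] V3) {S : Finset (Fin (m + 1))}
    {i j : Fin (m + 1)} (hi : i ∈ S) (hj : j ∈ S) {U : (Fin (m + 1) → V3) → ℝ} (hUm : Measurable U)
    (hU1 : ∀ x, U (fun k => if k ∈ S then x i + h (x k - x i) else x k) = U x) {D R₀ : ℝ}
    (hU2 : ∀ x, U x ≠ 0 → ‖x i - x j‖ ≤ R₀ → ∀ k ∈ S, ‖x k - x i‖ ≤ D) {ψ : V3 → ℝ} (hψm : Measurable ψ)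
    (hψs : ∀ q, ψ q ≠ 0 → ‖q‖ ≤ R₀) :
    ∫ x, {y : V3 | ∀ c, D ≤ y c ∧ y c ≤ L - D}.indicator (fun _ => (1 : ℝ)) (x i) * ψ (x i - x j) * U x
        ∂(Measure.pi fun _ : Fin (m + 1) => volume[|cellCube L]) =
      ∫ x, {y : V3 | ∀ c, D ≤ y c ∧ y c ≤ L - D}.indicator (fun _ => (1 : ℝ)) (x i) * ψ (h (x i - x j)) * U x
        ∂(Measure.pi fun _ : Fin (m + 1) => volume[|cellCube L]) := by
  have hbox : MeasurableSet (Set.pi Set.univ fun _ : Fin (m + 1) => cellCube L) :=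
    MeasurableSet.univ_pi fun _ => measurableSet_cellCube L
  have hBm : Measurable fun x : Fin (m + 1) → V3 =>
      {y : V3 | ∀ c, D ≤ y c ∧ y c ≤ L - D}.indicator (fun _ => (1 : ℝ)) (x i) :=
    (measurable_const.indicator (measurableSet_bulk L D)).comp (measurable_pi_apply i)
  have hij : Measurable fun x : Fin (m + 1) → V3 => x i - x j := (measurable_pi_apply i).sub (measurable_pi_apply j)
  have hGm : Measurable fun x : Fin (m + 1) → V3 =>
      {y : V3 | ∀ c, D ≤ y c ∧ y c ≤ L - D}.indicator (fun _ => (1 : ℝ)) (x i) * ψ (x i - x j) * U x :=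
    (hBm.mul (hψm.comp hij)).mul hUm
  have hG'm : Measurable fun x : Fin (m + 1) → V3 =>
      {y : V3 | ∀ c, D ≤ y c ∧ y c ≤ L - D}.indicator (fun _ => (1 : ℝ)) (x i) * ψ (h (x i - x j)) * U x :=
    (hBm.mul (hψm.comp (h.continuous.measurable.comp hij))).mul hUm
  have hT := measurePreserving_recentre h i S
  rw [pi_cond_cellCube L (m + 1), ProbabilityTheory.cond, integral_smul_measure, integral_smul_measure,
    ← integral_indicator hbox, ← integral_indicator hbox]
  congr 1
  calc ∫ x, (Set.pi Set.univ fun _ : Fin (m + 1) => cellCube L).indicator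
        (fun x => {y : V3 | ∀ c, D ≤ y c ∧ y c ≤ L - D}.indicator (fun _ => (1 : ℝ)) (x i) * ψ (x i - x j) * U x) x
      = ∫ x, (Set.pi Set.univ fun _ : Fin (m + 1) => cellCube L).indicator
          (fun x => {y : V3 | ∀ c, D ≤ y c ∧ y c ≤ L - D}.indicator (fun _ => (1 : ℝ)) (x i) * ψ (x i - x j) * U x) x
          ∂(Measure.map (fun x : Fin (m + 1) → V3 => fun k => if k ∈ S then x i + h (x k - x i) else x k) volume) := by
        rw [hT.map_eq]
    _ = ∫ x, (Set.pi Set.univ fun _ : Fin (m + 1) => cellCube L).indicator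
          (fun x => {y : V3 | ∀ c, D ≤ y c ∧ y c ≤ L - D}.indicator (fun _ => (1 : ℝ)) (x i) * ψ (x i - x j) * U x)
          (fun k => if k ∈ S then x i + h (x k - x i) else x k) :=
        integral_map hT.measurable.aemeasurable ((hGm.indicator hbox).aestronglyMeasurable)
    _ = _ := integral_congr_ae (Eventually.of_forall fun x => indicator_bracket_recentre L h hi hj hU1 hU2 hψs x)

/-- **Registered sub-goal `stub_contactStatistics_bulk`** (piece of stub `stub_contactStatistics`, S2c, of the line
`enskog-compensator-martingale`): the two geometric inputs of the weak isotropy of the pair law of the cell — (i) the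
bulk invariance of the brackets of the two-marked expansion under linear isometries acting about the marked centre
(`integral_bulk_bracket_eq`), and (ii) recentring preserves the Ursell weights of the clusters inside the recentred
labels while a non-vanishing Ursell weight `u_B` confines `B` within `(#B − 1)σ` of any of its centres. [folklore] -/
theorem stub_contactStatistics_bulk : (∀ (m : ℕ) (L : ℝ) (h : V3 ≃ₗᵢ[ℝ] V3) (S : Finset (Fin (m + 1)))
    (i j : Fin (m + 1)), i ∈ S → j ∈ S → ∀ (U : (Fin (m + 1) → V3) → ℝ), Measurable U →
    (∀ x, U (fun k => if k ∈ S then x i + h (x k - x i) else x k) = U x) → ∀ (D R₀ : ℝ),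
    (∀ x, U x ≠ 0 → ‖x i - x j‖ ≤ R₀ → ∀ k ∈ S, ‖x k - x i‖ ≤ D) → ∀ (ψ : V3 → ℝ), Measurable ψ →
    (∀ q, ψ q ≠ 0 → ‖q‖ ≤ R₀) →
    ∫ x, {y : V3 | ∀ c, D ≤ y c ∧ y c ≤ L - D}.indicator (fun _ => (1 : ℝ)) (x i) * ψ (x i - x j) * U x
        ∂(Measure.pi fun _ : Fin (m + 1) => ProbabilityTheory.cond volume {y : V3 | ∀ k, y k ∈ Set.Icc (0 : ℝ) L}) =
      ∫ x, {y : V3 | ∀ c, D ≤ y c ∧ y c ≤ L - D}.indicator (fun _ => (1 : ℝ)) (x i) * ψ (h (x i - x j)) * U x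
        ∂(Measure.pi fun _ : Fin (m + 1) => ProbabilityTheory.cond volume {y : V3 | ∀ k, y k ∈ Set.Icc (0 : ℝ) L})) ∧
    (∀ (m : ℕ) (σ : ℝ) (h : V3 ≃ₗᵢ[ℝ] V3) (i : Fin (m + 1)) (S B : Finset (Fin (m + 1))), B ⊆ S →
      ∀ x : Fin (m + 1) → V3, uR (fun y y' : V3 => ‖y - y'‖ < σ) (fun k => if k ∈ S then x i + h (x k - x i) else x k) B =
        uR (fun y y' : V3 => ‖y - y'‖ < σ) x B) ∧
    (∀ (n : ℕ) (σ : ℝ), 0 ≤ σ → ∀ (x : Fin n → V3) (B : Finset (Fin n)),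
      uR (fun y y' : V3 => ‖y - y'‖ < σ) x B ≠ 0 → ∀ u ∈ B, ∀ w ∈ B, ‖x u - x w‖ ≤ ((B.card : ℝ) - 1) * σ) :=
  ⟨fun _ L h _ _ _ hi hj _ hUm hU1 _ _ hU2 _ hψm hψs => integral_bulk_bracket_eq L h hi hj hUm hU1 hU2 hψm hψs,
    fun _ σ h i _ _ hBS x => uR_recentre σ h i hBS x,
    fun _ _ hσ _ _ hB => norm_sub_le_of_uR_ne_zero hσ hB⟩

end Summit.AtomisticToContinuum.HydrodynamicLimit.Theorems.EnskogCompensator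

end
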